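import Literature.NumberTheory.Automorphic.ArchOrbitMeasurePartialTestFunction      -- ★ (R1-a) `exists_contDiff_eq_integral_insert` (N-general)
import Literature.NumberTheory.Automorphic.ArchLocalTorusOrbitalBlockSmooth           -- ★ (A1) p842196 `contDiffOn_integral_comp_conj_circleDiagonal_angles_of_blocks` (regular smoothness, N-general)
import Literature.NumberTheory.Automorphic.ArchLocalTorusOrbitalCompactWallContinuity -- ★ `isOpen_setOf_blockSeparated`
import Literature.NumberTheory.Rogawski1990.ArchCentralLimitFunctionalEngine        -- ★ (F0P3a-p06): `isOpen_setOf_injective_fin_circle`; brings ★ p842285 N7-bis COLLAPSE `tendsto_lambda8_rhoWeylDelta_mul_comp_perm`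
import HarnessLib

/-!
# THE SINGLE-PLACE ENGINE OF THE RANK-2 DESCENT OVER PLACES for (S-d): Harish-Chandra's central limit formula at one place, read on the LABEL SUM of mixed partial orbital
# integrals of a test function of `G′_∞ = ∏_w G_w` (Rogawski 1990 §8.4 pp. 126–127 «`ω[ρΔΦ^{st}](γ₀) = 3c_G f(γ₀)`», §14.5 p. 239 «from the limit formulas if `v ∈ S₀`»)

Topic `NumberTheory/Automorphic`; namespace `Literature.NumberTheory.Automorphic.UnitaryGroup`.  THEOREMS ONLY (no `def`, no instance, no notation, no axiom, no named fact, no `sorry`).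
Cell `pub/hodgecm-mathlib`, ENGINE T1 (crux H413 = `stmt-HodgeConjecture-24833`); ROAD-Sd residual R4 (`stub_SdCanonical` of `Cruxes/H413/Lines/F0_P3a_SdArch.lean`), SdArch ED. 3 node **N5 «E2-central»**
(LEAD F0P3a-plan (g9) WORD T8-135; census `CENSUS-N5-ArchCentralDescentRankTwo.F0P3a-p03g11.md` 783c9612 §2a), FILE A1; author F0P3a-p03 (g11), 2026-09-01.  The abstract two-sided descent is
★ `ArchCentralDescentBookkeeping` (F0P3a-p06 (g11)); this file and its sequel `ArchCentralDescentRankTwoStep` (the `hstep` instance) supply its analytic input.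

THE FUNCTIONAL.  `Λ_x[Φ] := (1∕48) Σ_{ε : Fin 3 → Bool} s₀s₁s₂ · (d∕ds)³|₀ [ρ′Δ(r_ε(s)) · Φ(r_ε(s))]`, `r_ε(s)_k = x_k e^{is(V_ε)_k}`, `V_ε = (s₀+s₁, −s₀+s₂, −s₁−s₂)`, `ρ′Δ(r) = r₀r₂⁻¹∏(1 − r_jr_i⁻¹)` — the
(L_{U(2,1)}) letter ★ `ArchCentralLimitFormulaRankTwo` (F0P3a-p02 (g11)) with its orbital integral replaced by `Φ`, in the letter's BETA-REDUCED tokens (so that the opened letter `hL` is consumed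
verbatim); ★ p842285∕`ArchCentralLimitFunctionalEngine` (F0P3a-p06) carry the same functional with the redex `(fun z′ => ρ′Δ z′ · Φ z′) (r_ε s)` — `beta_reduce` converts.

WHAT IS PROVED.
§1 `contDiff_rhoWeylDelta_ray` (`ρ′Δ ∘ r` is smooth in `s`); `lambda8_rhoWeylDelta_mul_finset_sum` (additivity of `Λ_x` over a finite sum when every ray function is `C³` at `0`);
   `eventually_injective_ray` (rays from a regular point stay regular); **`lambda8_rhoWeylDelta_mul_congr`** (LOCALITY: functions agreeing on the regular set
   have the same `Λ_x` at regular `x` — the `hΛcongr` of ★ `descent_two_sided_prod_mul_eq`); **`lambda8_rhoWeylDelta_mul_const_mul`** (homogeneity — its `hΛmul`).  (Reduced-token twins of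
   F0P3a-p06's `lambda8_rhoWeylDelta_congr_of_eqOn` ∕ `…_const_mul` ∕ `…_finset_sum`.)
§2 **`tendsto_lambda8_sum_perm_integral_integral_insert`** — THE ENGINE: at a complex place `w₁` (real frame, `α_i ≠ 0`), Haar `ν` on `G_{w₁}`, the letter OPENED at `w₁` with constant `c`
   (`hL`; from ★ `ArchCentralLimitFormulaRankTwo` at an indefinite place, from ★ `exists_tendsto_letterLambda_nhdsWithin_of_posDef` at a definite one), finitely many Radon σ-finite families `μ_j`
   at the other places, an ambient test function `Θ` of `∏_w G_w`:
   `Λ_x[Σ_{τ∈S₃} Σ_j ∫_{G_{w₁}} ∫ Θ(e⁻¹(k·diag(x∘τ)·k⁻¹, o)) d(⊗μ_j) dν] → −(c·i)·Σ_τ Σ_j ∫ Θ(e⁻¹(diag(ζ,ζ,ζ), o)) d(⊗μ_j)` as `x → (ζ,ζ,ζ)` through regular points.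
   Mechanism: ★ (R1-a) makes each inner integral the orbital integral of a smooth compactly supported `Θ̃_j`; at REGULAR `x` every ray function is `C^∞` (★ (A1), `b := id`), so `Λ_x` is additive
   over the `6·|J|` terms; each tends to `−(c·i)·Θ̃_j(ζ·1)` by `hL` and the COLLAPSE lemma (every label contributes the same constant — print's «3 classes × c_G»); `Θ̃_j(ζ·1)` is the frozen integral.
HONEST LABEL: HC_CM is proved only modulo the printed citations until rung 0 closes; this file is real analysis over ★ (R1-a)∕(A1)∕N7-bis and pays nothing by itself — the letter enters ONLY
through the hypothesis `hL`.

## References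
* [Rogawski1990] J. D. Rogawski, *Automorphic Representations of Unitary Groups in Three Variables*, Ann. of Math. Stud. 123 (1990), §8.4 pp. 126–127, §14.5 p. 239, §8.3 p. 122.
* [Varadarajan1989] V. S. Varadarajan, *An Introduction to Harmonic Analysis on Semisimple Lie Groups* (1989), §6.4.
* [HormanderALPDO1] L. Hörmander, *The Analysis of Linear Partial Differential Operators I*, 2nd ed. (1990), Thm. 1.1.9.
-/

set_option autoImplicit false

noncomputable section

open MeasureTheory Matrix NumberField NumberField.InfinitePlace NumberField.mixedEmbedding Set Function Filter Topology
open scoped MatrixGroups ContDiff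

namespace Literature.NumberTheory.Automorphic.UnitaryGroup

open Literature.NumberTheory.Rogawski1990 Literature.Analysis.Calculus

-- the scoped `L^∞`-operator norm on `M_N(ℂ)` and `M_N(L ⊗ ℝ)`, the cell's ambient-smooth convention
open scoped Matrix.Norms.Operator

/-! ## §1 The letter's functional `Λ₈[ρ′Δ · −]`: smooth rays, linearity over finite sums at a point -/

section Lambda

/-- The letter's prefactor `ρ′Δ` along a ray `s ↦ x·e^{isu}` is smooth in `s` (products and inverses of the nonvanishing `↑(x_k e^{isu_k})`). [cite: Rogawski1990, §8.4 p. 126] -/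
theorem contDiff_rhoWeylDelta_ray (x : Fin 3 → Circle) (u : Fin 3 → ℝ) :
    ContDiff ℝ ∞ fun s : ℝ => (((((x 0 * Circle.exp (s * (u 0))) : Circle) : ℂ)) * ((((x 2 * Circle.exp (s * (u 2))) : Circle) : ℂ))⁻¹) * ((1 - ((((x 1 * Circle.exp (s * (u 1))) : Circle) : ℂ)) * ((((x 0 * Circle.exp (s * (u 0))) : Circle) : ℂ))⁻¹) * (1 - ((((x 2 * Circle.exp (s * (u 2))) : Circle) : ℂ)) * ((((x 1 * Circle.exp (s * (u 1))) : Circle) : ℂ))⁻¹) * (1 - ((((x 2 * Circle.exp (s * (u 2))) : Circle) : ℂ)) * ((((x 0 * Circle.exp (s * (u 0))) : Circle) : ℂ))⁻¹)) := by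
  have hatom : ∀ k : Fin 3, ContDiff ℝ ∞ (fun s : ℝ => (((x k * Circle.exp (s * (u k))) : Circle) : ℂ)) := by
    intro k
    simp only [Circle.coe_mul, Circle.coe_exp]
    exact contDiff_const.mul (Complex.contDiff_exp.comp ((Complex.ofRealCLM.contDiff.comp (contDiff_id.mul contDiff_const)).mul contDiff_const))
  have hinv : ∀ k : Fin 3, ContDiff ℝ ∞ (fun s : ℝ => ((((x k * Circle.exp (s * (u k))) : Circle) : ℂ))⁻¹) :=
    fun k => (hatom k).inv fun s => Circle.coe_ne_zero _
  exact ((hatom 0).mul (hinv 2)).mul (((contDiff_const.sub ((hatom 1).mul (hinv 0))).mul (contDiff_const.sub ((hatom 2).mul (hinv 1)))).mul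
    (contDiff_const.sub ((hatom 2).mul (hinv 0))))

/-- **`Λ₈[ρ′Δ · −]` IS ADDITIVE OVER FINITE SUMS AT A POINT WHERE EVERY RAY FUNCTION IS `C³`** (`iteratedDeriv_fun_sum`; the hypothesis is asked for every direction `u`, which
covers the eight rays). [cite: Rogawski1990, §8.4 p. 126] -/
theorem lambda8_rhoWeylDelta_mul_finset_sum {ι : Type*} (I : Finset ι) (F : ι → (Fin 3 → Circle) → ℂ) (x : Fin 3 → Circle)
    (hF : ∀ i ∈ I, ∀ u : Fin 3 → ℝ, ContDiffAt ℝ 3 (fun s : ℝ => ((((((x 0 * Circle.exp (s * (u 0))) : Circle) : ℂ)) * ((((x 2 * Circle.exp (s * (u 2))) : Circle) : ℂ))⁻¹) * ((1 - ((((x 1 * Circle.exp (s * (u 1))) : Circle) : ℂ)) * ((((x 0 * Circle.exp (s * (u 0))) : Circle) : ℂ))⁻¹) * (1 - ((((x 2 * Circle.exp (s * (u 2))) : Circle) : ℂ)) * ((((x 1 * Circle.exp (s * (u 1))) : Circle) : ℂ))⁻¹) * (1 - ((((x 2 * Circle.exp (s * (u 2))) : Circle) : ℂ)) * ((((x 0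 * Circle.exp (s * (u 0))) : Circle) : ℂ))⁻¹))) * F i (fun k => x k * Circle.exp (s * (u k)))) 0) :
    (1 / 48 : ℂ) * ∑ ε : Fin 3 → Bool, ((((if ε 0 then (1 : ℝ) else -1) * (if ε 1 then (1 : ℝ) else -1) * (if ε 2 then (1 : ℝ) else -1) : ℝ)) : ℂ) *
          iteratedDeriv 3 (fun s : ℝ => ((((((x 0 * Circle.exp (s * (![(if ε 0 then (1 : ℝ) else -1) + (if ε 1 then (1 : ℝ) else -1), -(if ε 0 then (1 : ℝ) else -1) + (if ε 2 then (1 : ℝ) else -1), -(if ε 1 then (1 : ℝ) else -1) - (if ε 2 then (1 : ℝ) else -1)] 0))) : Circle) : ℂ)) * ((((x 2 * Circle.exp (s * (![(if ε 0 then (1 : ℝ) else -1) + (if ε 1 then (1 : ℝ) else -1), -(if ε 0 then (1 : ℝ) else -1) + (if ε 2 then (1 : ℝ) else -1), -(if ε 1 then (1 : ℝ) else -1) - (if ε 2 then (1 : ℝ) else -1)] 2))) : Circle) : ℂ))⁻¹) * ((1 - ((((x 1 * Circle.exp (s * (![(if ε 0 then (1 : ℝ) else -1) + (if ε 1 then (1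 : ℝ) else -1), -(if ε 0 then (1 : ℝ) else -1) + (if ε 2 then (1 : ℝ) else -1), -(if ε 1 then (1 : ℝ) else -1) - (if ε 2 then (1 : ℝ) else -1)] 1))) : Circle) : ℂ)) * ((((x 0 * Circle.exp (s * (![(if ε 0 then (1 : ℝ) else -1) + (if ε 1 then (1 : ℝ) else -1), -(if ε 0 then (1 : ℝ) else -1) + (if ε 2 then (1 : ℝ) else -1), -(if ε 1 then (1 : ℝ) else -1) - (if ε 2 then (1 : ℝ) else -1)] 0))) : Circle) : ℂ))⁻¹) * (1 - ((((x 2 * Circle.exp (s * (![(if ε 0 then (1 : ℝ) else -1) + (if ε 1 then (1 : ℝ) else -1), -(if ε 0 then (1 : ℝ) else -1) + (if ε 2 then (1 : ℝ) else -1), -(if ε 1 then (1 : ℝ) else -1) - (if ε 2 then (1 : ℝ) else -1)] 2))) : Circle) : ℂ)) * ((((x 1 * Circle.exp (s * (![(if ε 0 then (1 : ℝ) else -1) + (if ε 1 then (1 : ℝ) else -1), -(if ε 0 then (1 : ℝ) else -1) + (if ε 2 then (1 : ℝ) else -1), -(if ε 1 then (1 : ℝ) else -1) - (if ε 2 then (1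 : ℝ) else -1)] 1))) : Circle) : ℂ))⁻¹) * (1 - ((((x 2 * Circle.exp (s * (![(if ε 0 then (1 : ℝ) else -1) + (if ε 1 then (1 : ℝ) else -1), -(if ε 0 then (1 : ℝ) else -1) + (if ε 2 then (1 : ℝ) else -1), -(if ε 1 then (1 : ℝ) else -1) - (if ε 2 then (1 : ℝ) else -1)] 2))) : Circle) : ℂ)) * ((((x 0 * Circle.exp (s * (![(if ε 0 then (1 : ℝ) else -1) + (if ε 1 then (1 : ℝ) else -1), -(if ε 0 then (1 : ℝ) else -1) + (if ε 2 then (1 : ℝ) else -1), -(if ε 1 then (1 : ℝ) else -1) - (if ε 2 then (1 : ℝ) else -1)] 0))) : Circle) : ℂ))⁻¹))) * (∑ i ∈ I, F i (fun k => x k * Circle.exp (s * (![(if ε 0 then (1 : ℝ) else -1) + (if ε 1 then (1 : ℝ) else -1), -(if ε 0 then (1 : ℝ) else -1) + (if ε 2 then (1 : ℝ) else -1), -(if ε 1 then (1 : ℝ) else -1) - (if ε 2 then (1 : ℝ) else -1)] k))))) 0 =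
      ∑ i ∈ I, ((1 / 48 : ℂ) * ∑ ε : Fin 3 → Bool, ((((if ε 0 then (1 : ℝ) else -1) * (if ε 1 then (1 : ℝ) else -1) * (if ε 2 then (1 : ℝ) else -1) : ℝ)) : ℂ) *
          iteratedDeriv 3 (fun s : ℝ => ((((((x 0 * Circle.exp (s * (![(if ε 0 then (1 : ℝ) else -1) + (if ε 1 then (1 : ℝ) else -1), -(if ε 0 then (1 : ℝ) else -1) + (if ε 2 then (1 : ℝ) else -1), -(if ε 1 then (1 : ℝ) else -1) - (if ε 2 then (1 : ℝ) else -1)] 0))) : Circle) : ℂ)) * ((((x 2 * Circle.exp (s * (![(if ε 0 then (1 : ℝ) else -1) + (if ε 1 then (1 : ℝ) else -1), -(if ε 0 then (1 : ℝ) else -1) + (if ε 2 then (1 : ℝ) else -1), -(if ε 1 then (1 : ℝ) else -1) - (if ε 2 then (1 : ℝ) else -1)] 2))) : Circle) : ℂ))⁻¹) * ((1 - ((((x 1 * Circle.exp (s * (![(if ε 0 then (1 : ℝ) else -1) + (if ε 1 then (1 : ℝ) else -1), -(if ε 0 then (1 : ℝ) else -1) + (if ε 2 then (1 : ℝ) else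 -1), -(if ε 1 then (1 : ℝ) else -1) - (if ε 2 then (1 : ℝ) else -1)] 1))) : Circle) : ℂ)) * ((((x 0 * Circle.exp (s * (![(if ε 0 then (1 : ℝ) else -1) + (if ε 1 then (1 : ℝ) else -1), -(if ε 0 then (1 : ℝ) else -1) + (if ε 2 then (1 : ℝ) else -1), -(if ε 1 then (1 : ℝ) else -1) - (if ε 2 then (1 : ℝ) else -1)] 0))) : Circle) : ℂ))⁻¹) * (1 - ((((x 2 * Circle.exp (s * (![(if ε 0 then (1 : ℝ) else -1) + (if ε 1 then (1 : ℝ) else -1), -(if ε 0 then (1 : ℝ) else -1) + (if ε 2 then (1 : ℝ) else -1), -(if ε 1 then (1 : ℝ) else -1) - (if ε 2 then (1 : ℝ) else -1)] 2))) : Circle) : ℂ)) * ((((x 1 * Circle.exp (s * (![(if ε 0 then (1 : ℝ) else -1) + (if ε 1 then (1 : ℝ) else -1), -(if ε 0 then (1 : ℝ) else -1) + (if ε 2 then (1 : ℝ) else -1), -(if ε 1 then (1 : ℝ) else -1) - (if ε 2 then (1 : ℝ) else -1)] 1))) : Circle) : ℂ))⁻¹) * (1 - ((((x 2 * Circle.exp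 (s * (![(if ε 0 then (1 : ℝ) else -1) + (if ε 1 then (1 : ℝ) else -1), -(if ε 0 then (1 : ℝ) else -1) + (if ε 2 then (1 : ℝ) else -1), -(if ε 1 then (1 : ℝ) else -1) - (if ε 2 then (1 : ℝ) else -1)] 2))) : Circle) : ℂ)) * ((((x 0 * Circle.exp (s * (![(if ε 0 then (1 : ℝ) else -1) + (if ε 1 then (1 : ℝ) else -1), -(if ε 0 then (1 : ℝ) else -1) + (if ε 2 then (1 : ℝ) else -1), -(if ε 1 then (1 : ℝ) else -1) - (if ε 2 then (1 : ℝ) else -1)] 0))) : Circle) : ℂ))⁻¹))) * (F i (fun k => x k * Circle.exp (s * (![(if ε 0 then (1 : ℝ) else -1) + (if ε 1 then (1 : ℝ) else -1), -(if ε 0 then (1 : ℝ) else -1) + (if ε 2 then (1 : ℝ) else -1), -(if ε 1 then (1 : ℝ) else -1) - (if ε 2 then (1 : ℝ) else -1)] k))))) 0) := by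
  have h1 : ∀ u : Fin 3 → ℝ, iteratedDeriv 3 (fun s : ℝ => ((((((x 0 * Circle.exp (s * (u 0))) : Circle) : ℂ)) * ((((x 2 * Circle.exp (s * (u 2))) : Circle) : ℂ))⁻¹) * ((1 - ((((x 1 * Circle.exp (s * (u 1))) : Circle) : ℂ)) * ((((x 0 * Circle.exp (s * (u 0))) : Circle) : ℂ))⁻¹) * (1 - ((((x 2 * Circle.exp (s * (u 2))) : Circle) : ℂ)) * ((((x 1 * Circle.exp (s * (u 1))) : Circle) : ℂ))⁻¹) * (1 - ((((x 2 * Circle.exp (s * (u 2))) : Circle) : ℂ)) * ((((x 0 * Circle.exp (s * (u 0))) : Circle) : ℂ))⁻¹))) * ∑ i ∈ I, F i (fun k => x k * Circle.exp (s * (u k)))) 0 =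
      ∑ i ∈ I, iteratedDeriv 3 (fun s : ℝ => ((((((x 0 * Circle.exp (s * (u 0))) : Circle) : ℂ)) * ((((x 2 * Circle.exp (s * (u 2))) : Circle) : ℂ))⁻¹) * ((1 - ((((x 1 * Circle.exp (s * (u 1))) : Circle) : ℂ)) * ((((x 0 * Circle.exp (s * (u 0))) : Circle) : ℂ))⁻¹) * (1 - ((((x 2 * Circle.exp (s * (u 2))) : Circle) : ℂ)) * ((((x 1 * Circle.exp (s * (u 1))) : Circle) : ℂ))⁻¹) * (1 - ((((x 2 * Circle.exp (s * (u 2))) : Circle) : ℂ)) * ((((x 0 * Circle.exp (s * (u 0))) : Circle) : ℂ))⁻¹))) * F i (fun k => x k * Circle.exp (s * (u k)))) 0 := by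
    intro u
    have hfun : (fun s : ℝ => ((((((x 0 * Circle.exp (s * (u 0))) : Circle) : ℂ)) * ((((x 2 * Circle.exp (s * (u 2))) : Circle) : ℂ))⁻¹) * ((1 - ((((x 1 * Circle.exp (s * (u 1))) : Circle) : ℂ)) * ((((x 0 * Circle.exp (s * (u 0))) : Circle) : ℂ))⁻¹) * (1 - ((((x 2 * Circle.exp (s * (u 2))) : Circle) : ℂ)) * ((((x 1 * Circle.exp (s * (u 1))) : Circle) : ℂ))⁻¹) * (1 - ((((x 2 * Circle.exp (s * (u 2))) : Circle) : ℂ)) * ((((x 0 * Circle.exp (s * (u 0))) : Circle) : ℂ))⁻¹))) * ∑ i ∈ I, F i (fun k => x k * Circle.exp (s * (u k)))) =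
        fun s : ℝ => ∑ i ∈ I, ((((((x 0 * Circle.exp (s * (u 0))) : Circle) : ℂ)) * ((((x 2 * Circle.exp (s * (u 2))) : Circle) : ℂ))⁻¹) * ((1 - ((((x 1 * Circle.exp (s * (u 1))) : Circle) : ℂ)) * ((((x 0 * Circle.exp (s * (u 0))) : Circle) : ℂ))⁻¹) * (1 - ((((x 2 * Circle.exp (s * (u 2))) : Circle) : ℂ)) * ((((x 1 * Circle.exp (s * (u 1))) : Circle) : ℂ))⁻¹) * (1 - ((((x 2 * Circle.exp (s * (u 2))) : Circle) : ℂ)) * ((((x 0 * Circle.exp (s * (u 0))) : Circle) : ℂ))⁻¹))) * F i (fun k => x k * Circle.exp (s * (u k))) := by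
      funext s; rw [Finset.mul_sum]
    rw [hfun, iteratedDeriv_fun_sum (fun i hi => hF i hi u)]
  simp only [h1]
  simp only [Finset.mul_sum]
  rw [Finset.sum_comm]

/-- **Rays from a regular point stay regular for small times**: `s ↦ x·e^{isu}` is continuous with value `x` at `s = 0`. [cite: Rogawski1990, §8.4 p. 126] -/
theorem eventually_injective_ray (x : Fin 3 → Circle) (hx : Function.Injective x) (u : Fin 3 → ℝ) :
    ∀ᶠ s : ℝ in 𝓝 0, Function.Injective (fun k => x k * Circle.exp (s * (u k))) := by
  have hc : Continuous fun s : ℝ => (fun k => x k * Circle.exp (s * (u k))) :=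
    continuous_pi fun k => continuous_const.mul (Circle.exp.continuous.comp (continuous_id.mul continuous_const))
  have h0 : (fun s : ℝ => (fun k => x k * Circle.exp (s * (u k)))) 0 ∈ {z : Fin 3 → Circle | Function.Injective z} := by
    simp only [zero_mul, Circle.exp_zero, mul_one, Set.mem_setOf_eq]
    exact hx
  exact hc.continuousAt.eventually_mem (isOpen_setOf_injective_fin_circle.mem_nhds h0)

/-- **CONGRUENCE OF `Λ₈[ρ′Δ · −]` ON THE REGULAR SET**: two functions that agree at regular points have the same functional at every regular point — each of the eight ray functions agree
near `s = 0` (★ `eventually_injective_ray`), so their third derivatives at `0` coincide (`Filter.EventuallyEq.iteratedDeriv_eq`).  This is the `hΛcongr` of ★ `descent_two_sided_prod_mul_eq`.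
[cite: Rogawski1990, §8.4 p. 126] -/
theorem lambda8_rhoWeylDelta_mul_congr (f g : (Fin 3 → Circle) → ℂ) (hfg : Set.EqOn f g {z : Fin 3 → Circle | Function.Injective z})
    (x : Fin 3 → Circle) (hx : Function.Injective x) :
    (1 / 48 : ℂ) * ∑ ε : Fin 3 → Bool, ((((if ε 0 then (1 : ℝ) else -1) * (if ε 1 then (1 : ℝ) else -1) * (if ε 2 then (1 : ℝ) else -1) : ℝ)) : ℂ) *
          iteratedDeriv 3 (fun s : ℝ => ((((((x 0 * Circle.exp (s * (![(if ε 0 then (1 : ℝ) else -1) + (if ε 1 then (1 : ℝ) else -1), -(if ε 0 then (1 : ℝ) else -1) + (if ε 2 then (1 : ℝ) else -1), -(if ε 1 then (1 : ℝ) else -1) - (if ε 2 then (1 : ℝ) else -1)] 0))) : Circle) : ℂ)) * ((((x 2 * Circle.exp (s * (![(if ε 0 then (1 : ℝ) else -1) + (if ε 1 then (1 : ℝ) else -1), -(if ε 0 then (1 : ℝ) else -1) + (if ε 2 then (1 : ℝ) else -1), -(if ε 1 then (1 : ℝ) else -1) - (if ε 2 then (1 : ℝ) else -1)] 2))) : Circle)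 : ℂ))⁻¹) * ((1 - ((((x 1 * Circle.exp (s * (![(if ε 0 then (1 : ℝ) else -1) + (if ε 1 then (1 : ℝ) else -1), -(if ε 0 then (1 : ℝ) else -1) + (if ε 2 then (1 : ℝ) else -1), -(if ε 1 then (1 : ℝ) else -1) - (if ε 2 then (1 : ℝ) else -1)] 1))) : Circle) : ℂ)) * ((((x 0 * Circle.exp (s * (![(if ε 0 then (1 : ℝ) else -1) + (if ε 1 then (1 : ℝ) else -1), -(if ε 0 then (1 : ℝ) else -1) + (if ε 2 then (1 : ℝ) else -1), -(if ε 1 then (1 : ℝ) else -1) - (if ε 2 then (1 : ℝ) else -1)] 0))) : Circle) : ℂ))⁻¹) * (1 - ((((x 2 * Circle.exp (s * (![(if ε 0 then (1 : ℝ) else -1) + (if ε 1 then (1 : ℝ) else -1), -(if ε 0 then (1 : ℝ) else -1) + (if ε 2 then (1 : ℝ) else -1), -(if ε 1 then (1 : ℝ) else -1) - (if ε 2 then (1 : ℝ) else -1)] 2))) : Circle) : ℂ)) * ((((x 1 * Circle.exp (s * (![(if ε 0 then (1 : ℝ) else -1) + (if ε 1 then (1 : ℝ) else -1), -(if ε 0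 then (1 : ℝ) else -1) + (if ε 2 then (1 : ℝ) else -1), -(if ε 1 then (1 : ℝ) else -1) - (if ε 2 then (1 : ℝ) else -1)] 1))) : Circle) : ℂ))⁻¹) * (1 - ((((x 2 * Circle.exp (s * (![(if ε 0 then (1 : ℝ) else -1) + (if ε 1 then (1 : ℝ) else -1), -(if ε 0 then (1 : ℝ) else -1) + (if ε 2 then (1 : ℝ) else -1), -(if ε 1 then (1 : ℝ) else -1) - (if ε 2 then (1 : ℝ) else -1)] 2))) : Circle) : ℂ)) * ((((x 0 * Circle.exp (s * (![(if ε 0 then (1 : ℝ) else -1) + (if ε 1 then (1 : ℝ) else -1), -(if ε 0 then (1 : ℝ) else -1) + (if ε 2 then (1 : ℝ) else -1), -(if ε 1 then (1 : ℝ) else -1) - (if ε 2 then (1 : ℝ) else -1)] 0))) : Circle) : ℂ))⁻¹))) * (f (fun k => x k * Circle.exp (s * (![(if ε 0 then (1 : ℝ) else -1) + (if ε 1 then (1 : ℝ) else -1), -(if ε 0 then (1 : ℝ) else -1) + (if ε 2 then (1 : ℝ) else -1), -(if ε 1 then (1 : ℝ) else -1) - (if ε 2 then (1 : ℝ) else -1)]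 k))))) 0 =
      (1 / 48 : ℂ) * ∑ ε : Fin 3 → Bool, ((((if ε 0 then (1 : ℝ) else -1) * (if ε 1 then (1 : ℝ) else -1) * (if ε 2 then (1 : ℝ) else -1) : ℝ)) : ℂ) *
          iteratedDeriv 3 (fun s : ℝ => ((((((x 0 * Circle.exp (s * (![(if ε 0 then (1 : ℝ) else -1) + (if ε 1 then (1 : ℝ) else -1), -(if ε 0 then (1 : ℝ) else -1) + (if ε 2 then (1 : ℝ) else -1), -(if ε 1 then (1 : ℝ) else -1) - (if ε 2 then (1 : ℝ) else -1)] 0))) : Circle) : ℂ)) * ((((x 2 * Circle.exp (s * (![(if ε 0 then (1 : ℝ) else -1) + (if ε 1 then (1 : ℝ) else -1), -(if ε 0 then (1 : ℝ) else -1) + (if ε 2 then (1 : ℝ) else -1), -(if ε 1 then (1 : ℝ) else -1) - (if ε 2 then (1 : ℝ) else -1)] 2))) : Circle) : ℂ))⁻¹) * ((1 - ((((x 1 * Circle.exp (s * (![(if ε 0 then (1 : ℝ) else -1) + (if ε 1 then (1 : ℝ) else -1), -(if ε 0 then (1 : ℝ) else -1) + (if ε 2 then (1 : ℝ) else -1),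 -(if ε 1 then (1 : ℝ) else -1) - (if ε 2 then (1 : ℝ) else -1)] 1))) : Circle) : ℂ)) * ((((x 0 * Circle.exp (s * (![(if ε 0 then (1 : ℝ) else -1) + (if ε 1 then (1 : ℝ) else -1), -(if ε 0 then (1 : ℝ) else -1) + (if ε 2 then (1 : ℝ) else -1), -(if ε 1 then (1 : ℝ) else -1) - (if ε 2 then (1 : ℝ) else -1)] 0))) : Circle) : ℂ))⁻¹) * (1 - ((((x 2 * Circle.exp (s * (![(if ε 0 then (1 : ℝ) else -1) + (if ε 1 then (1 : ℝ) else -1), -(if ε 0 then (1 : ℝ) else -1) + (if ε 2 then (1 : ℝ) else -1), -(if ε 1 then (1 : ℝ) else -1) - (if ε 2 then (1 : ℝ) else -1)] 2))) : Circle) : ℂ)) * ((((x 1 * Circle.exp (s * (![(if ε 0 then (1 : ℝ) else -1) + (if ε 1 then (1 : ℝ) else -1), -(if ε 0 then (1 : ℝ) else -1) + (if ε 2 then (1 : ℝ) else -1), -(if ε 1 then (1 : ℝ) else -1) - (if ε 2 then (1 : ℝ) else -1)] 1))) : Circle) : ℂ))⁻¹) * (1 - ((((x 2 * Circle.exp (s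 * (![(if ε 0 then (1 : ℝ) else -1) + (if ε 1 then (1 : ℝ) else -1), -(if ε 0 then (1 : ℝ) else -1) + (if ε 2 then (1 : ℝ) else -1), -(if ε 1 then (1 : ℝ) else -1) - (if ε 2 then (1 : ℝ) else -1)] 2))) : Circle) : ℂ)) * ((((x 0 * Circle.exp (s * (![(if ε 0 then (1 : ℝ) else -1) + (if ε 1 then (1 : ℝ) else -1), -(if ε 0 then (1 : ℝ) else -1) + (if ε 2 then (1 : ℝ) else -1), -(if ε 1 then (1 : ℝ) else -1) - (if ε 2 then (1 : ℝ) else -1)] 0))) : Circle) : ℂ))⁻¹))) * (g (fun k => x k * Circle.exp (s * (![(if ε 0 then (1 : ℝ) else -1) + (if ε 1 then (1 : ℝ) else -1), -(if ε 0 then (1 : ℝ) else -1) + (if ε 2 then (1 : ℝ) else -1), -(if ε 1 then (1 : ℝ) else -1) - (if ε 2 then (1 : ℝ) else -1)] k))))) 0 := by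
  have h1 : ∀ u : Fin 3 → ℝ, iteratedDeriv 3 (fun s : ℝ => ((((((x 0 * Circle.exp (s * (u 0))) : Circle) : ℂ)) * ((((x 2 * Circle.exp (s * (u 2))) : Circle) : ℂ))⁻¹) * ((1 - ((((x 1 * Circle.exp (s * (u 1))) : Circle) : ℂ)) * ((((x 0 * Circle.exp (s * (u 0))) : Circle) : ℂ))⁻¹) * (1 - ((((x 2 * Circle.exp (s * (u 2))) : Circle) : ℂ)) * ((((x 1 * Circle.exp (s * (u 1))) : Circle) : ℂ))⁻¹) * (1 - ((((x 2 * Circle.exp (s * (u 2))) : Circle) : ℂ)) * ((((x 0 * Circle.exp (s * (u 0))) : Circle) : ℂ))⁻¹))) * f (fun k => x k * Circle.exp (s * (u k)))) 0 =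
      iteratedDeriv 3 (fun s : ℝ => ((((((x 0 * Circle.exp (s * (u 0))) : Circle) : ℂ)) * ((((x 2 * Circle.exp (s * (u 2))) : Circle) : ℂ))⁻¹) * ((1 - ((((x 1 * Circle.exp (s * (u 1))) : Circle) : ℂ)) * ((((x 0 * Circle.exp (s * (u 0))) : Circle) : ℂ))⁻¹) * (1 - ((((x 2 * Circle.exp (s * (u 2))) : Circle) : ℂ)) * ((((x 1 * Circle.exp (s * (u 1))) : Circle) : ℂ))⁻¹) * (1 - ((((x 2 * Circle.exp (s * (u 2))) : Circle) : ℂ)) * ((((x 0 * Circle.exp (s * (u 0))) : Circle) : ℂ))⁻¹))) * g (fun k => x k * Circle.exp (s * (u k)))) 0 := by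
    intro u
    refine Filter.EventuallyEq.iteratedDeriv_eq 3 ?_
    filter_upwards [eventually_injective_ray x hx u] with s hs
    rw [hfg hs]
  simp only [h1]

/-- **HOMOGENEITY OF `Λ₈[ρ′Δ · −]`** (no differentiability needed: `iteratedDeriv_const_mul_field`).  This is the `hΛmul` of ★ `descent_two_sided_prod_mul_eq`. [cite: Rogawski1990, §8.4 p. 126] -/
theorem lambda8_rhoWeylDelta_mul_const_mul (a : ℂ) (f : (Fin 3 → Circle) → ℂ) (x : Fin 3 → Circle) :
    (1 / 48 : ℂ) * ∑ ε : Fin 3 → Bool, ((((if ε 0 then (1 : ℝ) else -1) * (if ε 1 then (1 : ℝ) else -1) * (if ε 2 then (1 : ℝ) else -1) : ℝ)) : ℂ) *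
          iteratedDeriv 3 (fun s : ℝ => ((((((x 0 * Circle.exp (s * (![(if ε 0 then (1 : ℝ) else -1) + (if ε 1 then (1 : ℝ) else -1), -(if ε 0 then (1 : ℝ) else -1) + (if ε 2 then (1 : ℝ) else -1), -(if ε 1 then (1 : ℝ) else -1) - (if ε 2 then (1 : ℝ) else -1)] 0))) : Circle) : ℂ)) * ((((x 2 * Circle.exp (s * (![(if ε 0 then (1 : ℝ) else -1) + (if ε 1 then (1 : ℝ) else -1), -(if ε 0 then (1 : ℝ) else -1) + (if ε 2 then (1 : ℝ) else -1), -(if ε 1 then (1 : ℝ) else -1) - (if ε 2 then (1 : ℝ) else -1)] 2))) : Circle) : ℂ))⁻¹) * ((1 - ((((x 1 * Circle.exp (s * (![(if ε 0 then (1 : ℝ) else -1) + (if ε 1 then (1 : ℝ) else -1), -(if ε 0 then (1 : ℝ) else -1) + (if ε 2 then (1 : ℝ) else -1), -(if ε 1 then (1 : ℝ) else -1) - (if ε 2 then (1 : ℝ) else -1)] 1))) : Circle) : ℂ)) * ((((x 0 * Circle.exp (s * (![(if ε 0 then (1 : ℝ) else -1) + (if ε 1 then (1 : ℝ) else -1),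 -(if ε 0 then (1 : ℝ) else -1) + (if ε 2 then (1 : ℝ) else -1), -(if ε 1 then (1 : ℝ) else -1) - (if ε 2 then (1 : ℝ) else -1)] 0))) : Circle) : ℂ))⁻¹) * (1 - ((((x 2 * Circle.exp (s * (![(if ε 0 then (1 : ℝ) else -1) + (if ε 1 then (1 : ℝ) else -1), -(if ε 0 then (1 : ℝ) else -1) + (if ε 2 then (1 : ℝ) else -1), -(if ε 1 then (1 : ℝ) else -1) - (if ε 2 then (1 : ℝ) else -1)] 2))) : Circle) : ℂ)) * ((((x 1 * Circle.exp (s * (![(if ε 0 then (1 : ℝ) else -1) + (if ε 1 then (1 : ℝ) else -1), -(if ε 0 then (1 : ℝ) else -1) + (if ε 2 then (1 : ℝ) else -1), -(if ε 1 then (1 : ℝ) else -1) - (if ε 2 then (1 : ℝ) else -1)] 1))) : Circle) : ℂ))⁻¹) * (1 - ((((x 2 * Circle.exp (s * (![(if ε 0 then (1 : ℝ) else -1) + (if ε 1 then (1 : ℝ) else -1), -(if ε 0 then (1 : ℝ) else -1) + (if ε 2 then (1 : ℝ) else -1), -(if ε 1 then (1 : ℝ) else -1) - (if ε 2 then (1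 : ℝ) else -1)] 2))) : Circle) : ℂ)) * ((((x 0 * Circle.exp (s * (![(if ε 0 then (1 : ℝ) else -1) + (if ε 1 then (1 : ℝ) else -1), -(if ε 0 then (1 : ℝ) else -1) + (if ε 2 then (1 : ℝ) else -1), -(if ε 1 then (1 : ℝ) else -1) - (if ε 2 then (1 : ℝ) else -1)] 0))) : Circle) : ℂ))⁻¹))) * (a * f (fun k => x k * Circle.exp (s * (![(if ε 0 then (1 : ℝ) else -1) + (if ε 1 then (1 : ℝ) else -1), -(if ε 0 then (1 : ℝ) else -1) + (if ε 2 then (1 : ℝ) else -1), -(if ε 1 then (1 : ℝ) else -1) - (if ε 2 then (1 : ℝ) else -1)] k))))) 0 =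
      a * ((1 / 48 : ℂ) * ∑ ε : Fin 3 → Bool, ((((if ε 0 then (1 : ℝ) else -1) * (if ε 1 then (1 : ℝ) else -1) * (if ε 2 then (1 : ℝ) else -1) : ℝ)) : ℂ) *
          iteratedDeriv 3 (fun s : ℝ => ((((((x 0 * Circle.exp (s * (![(if ε 0 then (1 : ℝ) else -1) + (if ε 1 then (1 : ℝ) else -1), -(if ε 0 then (1 : ℝ) else -1) + (if ε 2 then (1 : ℝ) else -1), -(if ε 1 then (1 : ℝ) else -1) - (if ε 2 then (1 : ℝ) else -1)] 0))) : Circle) : ℂ)) * ((((x 2 * Circle.exp (s * (![(if ε 0 then (1 : ℝ) else -1) + (if ε 1 then (1 : ℝ) else -1), -(if ε 0 then (1 : ℝ) else -1) + (if ε 2 then (1 : ℝ) else -1), -(if ε 1 then (1 : ℝ) else -1) - (if ε 2 then (1 : ℝ) else -1)] 2))) : Circle) : ℂ))⁻¹) * ((1 - ((((x 1 * Circle.exp (s * (![(if ε 0 then (1 : ℝ) else -1) + (if ε 1 then (1 : ℝ) else -1), -(if ε 0 then (1 : ℝ) else -1) + (if ε 2 then (1 : ℝ) else -1), -(if ε 1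 then (1 : ℝ) else -1) - (if ε 2 then (1 : ℝ) else -1)] 1))) : Circle) : ℂ)) * ((((x 0 * Circle.exp (s * (![(if ε 0 then (1 : ℝ) else -1) + (if ε 1 then (1 : ℝ) else -1), -(if ε 0 then (1 : ℝ) else -1) + (if ε 2 then (1 : ℝ) else -1), -(if ε 1 then (1 : ℝ) else -1) - (if ε 2 then (1 : ℝ) else -1)] 0))) : Circle) : ℂ))⁻¹) * (1 - ((((x 2 * Circle.exp (s * (![(if ε 0 then (1 : ℝ) else -1) + (if ε 1 then (1 : ℝ) else -1), -(if ε 0 then (1 : ℝ) else -1) + (if ε 2 then (1 : ℝ) else -1), -(if ε 1 then (1 : ℝ) else -1) - (if ε 2 then (1 : ℝ) else -1)] 2))) : Circle) : ℂ)) * ((((x 1 * Circle.exp (s * (![(if ε 0 then (1 : ℝ) else -1) + (if ε 1 then (1 : ℝ) else -1), -(if ε 0 then (1 : ℝ) else -1) + (if ε 2 then (1 : ℝ) else -1), -(if ε 1 then (1 : ℝ) else -1) - (if ε 2 then (1 : ℝ) else -1)] 1))) : Circle) : ℂ))⁻¹) * (1 - ((((x 2 * Circle.exp (s * (![(if ε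 0 then (1 : ℝ) else -1) + (if ε 1 then (1 : ℝ) else -1), -(if ε 0 then (1 : ℝ) else -1) + (if ε 2 then (1 : ℝ) else -1), -(if ε 1 then (1 : ℝ) else -1) - (if ε 2 then (1 : ℝ) else -1)] 2))) : Circle) : ℂ)) * ((((x 0 * Circle.exp (s * (![(if ε 0 then (1 : ℝ) else -1) + (if ε 1 then (1 : ℝ) else -1), -(if ε 0 then (1 : ℝ) else -1) + (if ε 2 then (1 : ℝ) else -1), -(if ε 1 then (1 : ℝ) else -1) - (if ε 2 then (1 : ℝ) else -1)] 0))) : Circle) : ℂ))⁻¹))) * (f (fun k => x k * Circle.exp (s * (![(if ε 0 then (1 : ℝ) else -1) + (if ε 1 then (1 : ℝ) else -1), -(if ε 0 then (1 : ℝ) else -1) + (if ε 2 then (1 : ℝ) else -1), -(if ε 1 then (1 : ℝ) else -1) - (if ε 2 then (1 : ℝ) else -1)] k))))) 0) := by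
  have h1 : ∀ u : Fin 3 → ℝ, iteratedDeriv 3 (fun s : ℝ => ((((((x 0 * Circle.exp (s * (u 0))) : Circle) : ℂ)) * ((((x 2 * Circle.exp (s * (u 2))) : Circle) : ℂ))⁻¹) * ((1 - ((((x 1 * Circle.exp (s * (u 1))) : Circle) : ℂ)) * ((((x 0 * Circle.exp (s * (u 0))) : Circle) : ℂ))⁻¹) * (1 - ((((x 2 * Circle.exp (s * (u 2))) : Circle) : ℂ)) * ((((x 1 * Circle.exp (s * (u 1))) : Circle) : ℂ))⁻¹) * (1 - ((((x 2 * Circle.exp (s * (u 2))) : Circle) : ℂ)) * ((((x 0 * Circle.exp (s * (u 0))) : Circle) : ℂ))⁻¹))) * (a * f (fun k => x k * Circle.exp (s * (u k))))) 0 =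
      a * iteratedDeriv 3 (fun s : ℝ => ((((((x 0 * Circle.exp (s * (u 0))) : Circle) : ℂ)) * ((((x 2 * Circle.exp (s * (u 2))) : Circle) : ℂ))⁻¹) * ((1 - ((((x 1 * Circle.exp (s * (u 1))) : Circle) : ℂ)) * ((((x 0 * Circle.exp (s * (u 0))) : Circle) : ℂ))⁻¹) * (1 - ((((x 2 * Circle.exp (s * (u 2))) : Circle) : ℂ)) * ((((x 1 * Circle.exp (s * (u 1))) : Circle) : ℂ))⁻¹) * (1 - ((((x 2 * Circle.exp (s * (u 2))) : Circle) : ℂ)) * ((((x 0 * Circle.exp (s * (u 0))) : Circle) : ℂ))⁻¹))) * f (fun k => x k * Circle.exp (s * (u k)))) 0 := by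
    intro u
    have hfun : (fun s : ℝ => ((((((x 0 * Circle.exp (s * (u 0))) : Circle) : ℂ)) * ((((x 2 * Circle.exp (s * (u 2))) : Circle) : ℂ))⁻¹) * ((1 - ((((x 1 * Circle.exp (s * (u 1))) : Circle) : ℂ)) * ((((x 0 * Circle.exp (s * (u 0))) : Circle) : ℂ))⁻¹) * (1 - ((((x 2 * Circle.exp (s * (u 2))) : Circle) : ℂ)) * ((((x 1 * Circle.exp (s * (u 1))) : Circle) : ℂ))⁻¹) * (1 - ((((x 2 * Circle.exp (s * (u 2))) : Circle) : ℂ)) * ((((x 0 * Circle.exp (s * (u 0))) : Circle) : ℂ))⁻¹))) * (a * f (fun k => x k * Circle.exp (s * (u k))))) = fun s : ℝ => a * (((((((x 0 * Circle.exp (s * (u 0))) : Circle) : ℂ)) * ((((x 2 * Circle.exp (s * (u 2))) : Circle) : ℂ))⁻¹) * ((1 - ((((x 1 * Circle.exp (s * (u 1))) : Circle) : ℂ)) * ((((x 0 * Circle.exp (s * (u 0))) : Circle) : ℂ))⁻¹) * (1 - ((((x 2 * Circle.exp (s * (u 2))) : Circle) : ℂ)) * ((((x 1 * Circle.exp (s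 * (u 1))) : Circle) : ℂ))⁻¹) * (1 - ((((x 2 * Circle.exp (s * (u 2))) : Circle) : ℂ)) * ((((x 0 * Circle.exp (s * (u 0))) : Circle) : ℂ))⁻¹))) * f (fun k => x k * Circle.exp (s * (u k)))) := by
      funext s; ring
    rw [hfun, iteratedDeriv_const_mul_field]
  simp only [h1, Finset.mul_sum]
  refine Finset.sum_congr rfl fun ε _ => ?_
  ring

end Lambda

/-! ## §2 THE SINGLE-PLACE ENGINE: the letter at `w₁`, read on the label sum of partial orbital integrals -/

section Engine

variable (L : Type) [Field L] [NumberField L] [IsCMField L] (α : Fin 3 → L)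
  [∀ w : {w : InfinitePlace L // IsComplex w}, MeasurableSpace (archLocal L 3 (Matrix.diagonal α) w)]
  [∀ w : {w : InfinitePlace L // IsComplex w}, BorelSpace (archLocal L 3 (Matrix.diagonal α) w)]

open scoped Classical in
/-- **THE SINGLE-PLACE ENGINE OF THE RANK-2 DESCENT.**  At a complex place `w₁` with Haar measure `ν` on `G_{w₁} = archLocal L 3 (diag α) w₁`, let the (L) letter hold at `w₁` in its OPENED
form `hL` with constant `c` (★ `ArchCentralLimitFormulaRankTwo` at an indefinite place, ★ `exists_tendsto_letterLambda_nhdsWithin_of_posDef` at a definite one).  For finitely many Radon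
σ-finite measure families `μ j` at the OTHER places and an ambient test function `Θ` of `G′_∞ = ∏_w G_w`, the letter's functional `Λ₈[ρ′Δ · −]` applied to the LABEL SUM
`x ↦ Σ_{τ ∈ S₃} Σ_j ∫_{G_{w₁}} ∫ Θ(e⁻¹(k·diag(x∘τ)·k⁻¹, o)) d(⊗μ_j)(o) dν(k)` tends, as `x → (ζ,ζ,ζ)` through regular points, to `−(c·i) · Σ_τ Σ_j ∫ Θ(e⁻¹(diag(ζ,ζ,ζ), o)) d(⊗μ_j)(o)`.
Mechanism: ★ (R1-a) `exists_contDiff_eq_integral_insert` makes each inner integral the orbital integral of a smooth compactly supported `Θ̃_j` on `G_{w₁}`; at a REGULAR `x` every ray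
function is `C^∞` (★ (A1) `contDiffOn_integral_comp_conj_circleDiagonal_angles_of_blocks`, `b := id`), so `Λ₈` is additive over the `6·|J|` terms (§1); each term tends to `−(c·i)·Θ̃_j(ζ·1)` by
the letter and the COLLAPSE lemma ★ `tendsto_lambda8_rhoWeylDelta_mul_comp_perm` (every label `τ` contributes the same constant); `Θ̃_j(ζ·1)` is the frozen integral.
[cite: Rogawski1990, §8.4 pp. 126–127; §14.5 p. 239] [cite: Varadarajan1989, §6.4] -/
theorem tendsto_lambda8_sum_perm_integral_integral_insert
    (hα : ∀ i, α i ≠ 0) (w₁ : {w : InfinitePlace L // IsComplex w}) (hreal : ∀ i, (w₁.1.embedding (α i)).im = 0)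
    (ν : Measure (archLocal L 3 (Matrix.diagonal α) w₁)) [ν.IsHaarMeasure]
    {J : Type*} [Fintype J] (μ : J → ∀ w' : {w : {w : InfinitePlace L // IsComplex w} // ¬ w = w₁}, Measure (archLocal L 3 (Matrix.diagonal α) w'.1))
    [∀ j w', IsFiniteMeasureOnCompacts (μ j w')] [∀ j w', SigmaFinite (μ j w')]
    (Θ : Matrix (Fin 3) (Fin 3) (mixedSpace L) → ℂ) (hΘ : ContDiff ℝ (⊤ : ℕ∞) Θ)
    (hΘc : HasCompactSupport fun g : arch (↥(maximalRealSubfield L)) L (IsCMField.complexConj L) 3 (Matrix.diagonal α) =>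
      Θ ((g : GL (Fin 3) (mixedSpace L)) : Matrix (Fin 3) (Fin 3) (mixedSpace L)))
    (ζ : Circle) (c : ℝ)
    (hL : ∀ (Θ' : Matrix (Fin 3) (Fin 3) ℂ → ℂ), ContDiff ℝ (⊤ : ℕ∞) Θ' →
        HasCompactSupport (fun k : archLocal L 3 (Matrix.diagonal α) w₁ => Θ' ((k : GL (Fin 3) ℂ) : Matrix (Fin 3) (Fin 3) ℂ)) →
        ∀ ζ' : Circle,
          Tendsto (fun x : Fin 3 → Circle =>
              (1 / 48 : ℂ) * ∑ ε : Fin 3 → Bool, ((((if ε 0 then (1 : ℝ) else -1) * (if ε 1 then (1 : ℝ) else -1) * (if ε 2 then (1 : ℝ) else -1) : ℝ)) : ℂ) *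
          iteratedDeriv 3 (fun s : ℝ => ((((((x 0 * Circle.exp (s * (![(if ε 0 then (1 : ℝ) else -1) + (if ε 1 then (1 : ℝ) else -1), -(if ε 0 then (1 : ℝ) else -1) + (if ε 2 then (1 : ℝ) else -1), -(if ε 1 then (1 : ℝ) else -1) - (if ε 2 then (1 : ℝ) else -1)] 0))) : Circle) : ℂ)) * ((((x 2 * Circle.exp (s * (![(if ε 0 then (1 : ℝ) else -1) + (if ε 1 then (1 : ℝ) else -1), -(if ε 0 then (1 : ℝ) else -1) + (if ε 2 then (1 : ℝ) else -1), -(if ε 1 then (1 : ℝ) else -1) - (if ε 2 then (1 : ℝ) else -1)] 2))) : Circle) : ℂ))⁻¹) * ((1 - ((((x 1 * Circle.exp (s * (![(if ε 0 then (1 : ℝ) else -1) + (if ε 1 then (1 : ℝ) else -1), -(if ε 0 then (1 : ℝ) else -1) + (if ε 2 then (1 : ℝ) else -1), -(if ε 1 then (1 : ℝ) else -1) - (if ε 2 then (1 : ℝ) else -1)] 1))) : Circle) : ℂ)) * ((((x 0 * Circle.exp (s * (![(if ε 0 then (1 : ℝ) else -1) + (if ε 1 then (1 : ℝ) else -1),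 -(if ε 0 then (1 : ℝ) else -1) + (if ε 2 then (1 : ℝ) else -1), -(if ε 1 then (1 : ℝ) else -1) - (if ε 2 then (1 : ℝ) else -1)] 0))) : Circle) : ℂ))⁻¹) * (1 - ((((x 2 * Circle.exp (s * (![(if ε 0 then (1 : ℝ) else -1) + (if ε 1 then (1 : ℝ) else -1), -(if ε 0 then (1 : ℝ) else -1) + (if ε 2 then (1 : ℝ) else -1), -(if ε 1 then (1 : ℝ) else -1) - (if ε 2 then (1 : ℝ) else -1)] 2))) : Circle) : ℂ)) * ((((x 1 * Circle.exp (s * (![(if ε 0 then (1 : ℝ) else -1) + (if ε 1 then (1 : ℝ) else -1), -(if ε 0 then (1 : ℝ) else -1) + (if ε 2 then (1 : ℝ) else -1), -(if ε 1 then (1 : ℝ) else -1) - (if ε 2 then (1 : ℝ) else -1)] 1))) : Circle) : ℂ))⁻¹) * (1 - ((((x 2 * Circle.exp (s * (![(if ε 0 then (1 : ℝ) else -1) + (if ε 1 then (1 : ℝ) else -1), -(if ε 0 then (1 : ℝ) else -1) + (if ε 2 then (1 : ℝ) else -1), -(if ε 1 then (1 : ℝ) else -1) - (if ε 2 then (1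 : ℝ) else -1)] 2))) : Circle) : ℂ)) * ((((x 0 * Circle.exp (s * (![(if ε 0 then (1 : ℝ) else -1) + (if ε 1 then (1 : ℝ) else -1), -(if ε 0 then (1 : ℝ) else -1) + (if ε 2 then (1 : ℝ) else -1), -(if ε 1 then (1 : ℝ) else -1) - (if ε 2 then (1 : ℝ) else -1)] 0))) : Circle) : ℂ))⁻¹))) * ((∫ g, Θ' (((g * ⟨circleDiagonal 3 (fun k => x k * Circle.exp (s * (![(if ε 0 then (1 : ℝ) else -1) + (if ε 1 then (1 : ℝ) else -1), -(if ε 0 then (1 : ℝ) else -1) + (if ε 2 then (1 : ℝ) else -1), -(if ε 1 then (1 : ℝ) else -1) - (if ε 2 then (1 : ℝ) else -1)] k))), circleDiagonal_mem_archLocal_diagonal L 3 α w₁ _⟩ * g⁻¹ : archLocal L 3 (Matrix.diagonal α) w₁) : GL (Fin 3) ℂ) : Matrix (Fin 3) (Fin 3) ℂ) ∂ν))) 0)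
            (𝓝[{x : Fin 3 → Circle | Function.Injective x}] (fun _ => ζ'))
            (𝓝 (-((c : ℂ) * Complex.I) * Θ' ((circleDiagonal 3 (fun _ => ζ') : GL (Fin 3) ℂ) : Matrix (Fin 3) (Fin 3) ℂ)))) :
    Tendsto (fun x : Fin 3 → Circle =>
        (1 / 48 : ℂ) * ∑ ε : Fin 3 → Bool, ((((if ε 0 then (1 : ℝ) else -1) * (if ε 1 then (1 : ℝ) else -1) * (if ε 2 then (1 : ℝ) else -1) : ℝ)) : ℂ) *
          iteratedDeriv 3 (fun s : ℝ => ((((((x 0 * Circle.exp (s * (![(if ε 0 then (1 : ℝ) else -1) + (if ε 1 then (1 : ℝ) else -1), -(if ε 0 then (1 : ℝ) else -1) + (if ε 2 then (1 : ℝ) else -1), -(if ε 1 then (1 : ℝ) else -1) - (if ε 2 then (1 : ℝ) else -1)] 0))) : Circle) : ℂ)) * ((((x 2 * Circle.exp (s * (![(if ε 0 then (1 : ℝ) else -1) + (if ε 1 then (1 : ℝ) else -1), -(if ε 0 then (1 : ℝ) else -1) + (if ε 2 then (1 : ℝ) else -1), -(if ε 1 then (1 : ℝ) else -1) - (if ε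 2 then (1 : ℝ) else -1)] 2))) : Circle) : ℂ))⁻¹) * ((1 - ((((x 1 * Circle.exp (s * (![(if ε 0 then (1 : ℝ) else -1) + (if ε 1 then (1 : ℝ) else -1), -(if ε 0 then (1 : ℝ) else -1) + (if ε 2 then (1 : ℝ) else -1), -(if ε 1 then (1 : ℝ) else -1) - (if ε 2 then (1 : ℝ) else -1)] 1))) : Circle) : ℂ)) * ((((x 0 * Circle.exp (s * (![(if ε 0 then (1 : ℝ) else -1) + (if ε 1 then (1 : ℝ) else -1), -(if ε 0 then (1 : ℝ) else -1) + (if ε 2 then (1 : ℝ) else -1), -(if ε 1 then (1 : ℝ) else -1) - (if ε 2 then (1 : ℝ) else -1)] 0))) : Circle) : ℂ))⁻¹) * (1 - ((((x 2 * Circle.exp (s * (![(if ε 0 then (1 : ℝ) else -1) + (if ε 1 then (1 : ℝ) else -1), -(if ε 0 then (1 : ℝ) else -1) + (if ε 2 then (1 : ℝ) else -1), -(if ε 1 then (1 : ℝ) else -1) - (if ε 2 then (1 : ℝ) else -1)] 2))) : Circle) : ℂ)) * ((((x 1 * Circle.exp (s * (![(if ε 0 then (1 : ℝ) else -1) + (if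 ε 1 then (1 : ℝ) else -1), -(if ε 0 then (1 : ℝ) else -1) + (if ε 2 then (1 : ℝ) else -1), -(if ε 1 then (1 : ℝ) else -1) - (if ε 2 then (1 : ℝ) else -1)] 1))) : Circle) : ℂ))⁻¹) * (1 - ((((x 2 * Circle.exp (s * (![(if ε 0 then (1 : ℝ) else -1) + (if ε 1 then (1 : ℝ) else -1), -(if ε 0 then (1 : ℝ) else -1) + (if ε 2 then (1 : ℝ) else -1), -(if ε 1 then (1 : ℝ) else -1) - (if ε 2 then (1 : ℝ) else -1)] 2))) : Circle) : ℂ)) * ((((x 0 * Circle.exp (s * (![(if ε 0 then (1 : ℝ) else -1) + (if ε 1 then (1 : ℝ) else -1), -(if ε 0 then (1 : ℝ) else -1) + (if ε 2 then (1 : ℝ) else -1), -(if ε 1 then (1 : ℝ) else -1) - (if ε 2 then (1 : ℝ) else -1)] 0))) : Circle) : ℂ))⁻¹))) * (∑ τ : Equiv.Perm (Fin 3), ∑ j : J, ∫ k : archLocal L 3 (Matrix.diagonal α) w₁, ∫ o : (∀ w' : {w : {w : InfinitePlace L // IsComplex w} // ¬ w = w₁}, archLocal L 3 (Matrix.diagonal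 α) w'.1),
            Θ ((((archPiEquivCM 3 L (Matrix.diagonal α)).symm
            ((MeasurableEquiv.piEquivPiSubtypeProd (fun w : {w : InfinitePlace L // IsComplex w} => ↥(archLocal L 3 (Matrix.diagonal α) w)) (· = w₁)).symm
              ((MeasurableEquiv.piUnique fun i : {w : {w : InfinitePlace L // IsComplex w} // w = w₁} => ↥(archLocal L 3 (Matrix.diagonal α) i.1)).symm ((k * ⟨circleDiagonal 3 ((fun k => x k * Circle.exp (s * (![(if ε 0 then (1 : ℝ) else -1) + (if ε 1 then (1 : ℝ) else -1), -(if ε 0 then (1 : ℝ) else -1) + (if ε 2 then (1 : ℝ) else -1), -(if ε 1 then (1 : ℝ) else -1) - (if ε 2 then (1 : ℝ) else -1)] k))) ∘ ⇑τ), circleDiagonal_mem_archLocal_diagonal L 3 α w₁ _⟩ * k⁻¹)), o)) :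
              arch (↥(maximalRealSubfield L)) L (IsCMField.complexConj L) 3 (Matrix.diagonal α)) : GL (Fin 3) (mixedSpace L)) : Matrix (Fin 3) (Fin 3) (mixedSpace L)) ∂(Measure.pi (μ j)) ∂ν)) 0)
      (𝓝[{x : Fin 3 → Circle | Function.Injective x}] (fun _ => ζ))
      (𝓝 (-((c : ℂ) * Complex.I) * ∑ _τ : Equiv.Perm (Fin 3), ∑ j : J, ∫ o : (∀ w' : {w : {w : InfinitePlace L // IsComplex w} // ¬ w = w₁}, archLocal L 3 (Matrix.diagonal α) w'.1),
            Θ ((((archPiEquivCM 3 L (Matrix.diagonal α)).symm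
            ((MeasurableEquiv.piEquivPiSubtypeProd (fun w : {w : InfinitePlace L // IsComplex w} => ↥(archLocal L 3 (Matrix.diagonal α) w)) (· = w₁)).symm
              ((MeasurableEquiv.piUnique fun i : {w : {w : InfinitePlace L // IsComplex w} // w = w₁} => ↥(archLocal L 3 (Matrix.diagonal α) i.1)).symm ((⟨circleDiagonal 3 (fun _ : Fin 3 => ζ), circleDiagonal_mem_archLocal_diagonal L 3 α w₁ _⟩ : archLocal L 3 (Matrix.diagonal α) w₁)), o)) :
              arch (↥(maximalRealSubfield L)) L (IsCMField.complexConj L) 3 (Matrix.diagonal α)) : GL (Fin 3) (mixedSpace L)) : Matrix (Fin 3) (Fin 3) (mixedSpace L)) ∂(Measure.pi (μ j)))) := by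
  haveI : ∀ w : {w : InfinitePlace L // IsComplex w}, SecondCountableTopology (archLocal L 3 (Matrix.diagonal α) w) :=
    fun w => secondCountableTopology_archLocal L 3 (Matrix.diagonal α) w
  haveI : ∀ w : {w : InfinitePlace L // IsComplex w}, LocallyCompactSpace (archLocal L 3 (Matrix.diagonal α) w) :=
    fun w => locallyCompactSpace_archLocal L 3 (Matrix.diagonal α) w
  -- §a the partial test functions `Θ̃_j` (★ (R1-a))
  choose Θt hΘt hΘtc hΘteq using fun j => exists_contDiff_eq_integral_insert L 3 α hα w₁ (μ j) Θ hΘ hΘc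
  obtain ⟨Φ, hΦ⟩ : ∃ Φ : J → (Fin 3 → Circle) → ℂ, Φ = fun j r => ∫ k : archLocal L 3 (Matrix.diagonal α) w₁,
      Θt j (((k * ⟨circleDiagonal 3 r, circleDiagonal_mem_archLocal_diagonal L 3 α w₁ r⟩ * k⁻¹ : archLocal L 3 (Matrix.diagonal α) w₁) : GL (Fin 3) ℂ) : Matrix (Fin 3) (Fin 3) ℂ) ∂ν := ⟨_, rfl⟩
  -- §b per label and per `j`: the letter + COLLAPSE
  have hlim : ∀ (τ : Equiv.Perm (Fin 3)) (j : J), Tendsto (fun x : Fin 3 → Circle =>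
      (1 / 48 : ℂ) * ∑ ε : Fin 3 → Bool, ((((if ε 0 then (1 : ℝ) else -1) * (if ε 1 then (1 : ℝ) else -1) * (if ε 2 then (1 : ℝ) else -1) : ℝ)) : ℂ) *
          iteratedDeriv 3 (fun s : ℝ => ((((((x 0 * Circle.exp (s * (![(if ε 0 then (1 : ℝ) else -1) + (if ε 1 then (1 : ℝ) else -1), -(if ε 0 then (1 : ℝ) else -1) + (if ε 2 then (1 : ℝ) else -1), -(if ε 1 then (1 : ℝ) else -1) - (if ε 2 then (1 : ℝ) else -1)] 0))) : Circle) : ℂ)) * ((((x 2 * Circle.exp (s * (![(if ε 0 then (1 : ℝ) else -1) + (if ε 1 then (1 : ℝ) else -1), -(if ε 0 then (1 : ℝ) else -1) + (if ε 2 then (1 : ℝ) else -1), -(if ε 1 then (1 : ℝ) else -1) - (if ε 2 then (1 : ℝ) else -1)] 2))) : Circle) : ℂ))⁻¹) * ((1 - ((((x 1 * Circle.exp (s * (![(if ε 0 then (1 : ℝ) else -1) + (if ε 1 then (1 : ℝ) else -1), -(if ε 0 then (1 : ℝ) else -1) + (if ε 2 then (1 : ℝ) else -1), -(if ε 1 then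 (1 : ℝ) else -1) - (if ε 2 then (1 : ℝ) else -1)] 1))) : Circle) : ℂ)) * ((((x 0 * Circle.exp (s * (![(if ε 0 then (1 : ℝ) else -1) + (if ε 1 then (1 : ℝ) else -1), -(if ε 0 then (1 : ℝ) else -1) + (if ε 2 then (1 : ℝ) else -1), -(if ε 1 then (1 : ℝ) else -1) - (if ε 2 then (1 : ℝ) else -1)] 0))) : Circle) : ℂ))⁻¹) * (1 - ((((x 2 * Circle.exp (s * (![(if ε 0 then (1 : ℝ) else -1) + (if ε 1 then (1 : ℝ) else -1), -(if ε 0 then (1 : ℝ) else -1) + (if ε 2 then (1 : ℝ) else -1), -(if ε 1 then (1 : ℝ) else -1) - (if ε 2 then (1 : ℝ) else -1)] 2))) : Circle) : ℂ)) * ((((x 1 * Circle.exp (s * (![(if ε 0 then (1 : ℝ) else -1) + (if ε 1 then (1 : ℝ) else -1), -(if ε 0 then (1 : ℝ) else -1) + (if ε 2 then (1 : ℝ) else -1), -(if ε 1 then (1 : ℝ) else -1) - (if ε 2 then (1 : ℝ) else -1)] 1))) : Circle) : ℂ))⁻¹) * (1 - ((((x 2 * Circle.exp (s * (![(if ε 0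 then (1 : ℝ) else -1) + (if ε 1 then (1 : ℝ) else -1), -(if ε 0 then (1 : ℝ) else -1) + (if ε 2 then (1 : ℝ) else -1), -(if ε 1 then (1 : ℝ) else -1) - (if ε 2 then (1 : ℝ) else -1)] 2))) : Circle) : ℂ)) * ((((x 0 * Circle.exp (s * (![(if ε 0 then (1 : ℝ) else -1) + (if ε 1 then (1 : ℝ) else -1), -(if ε 0 then (1 : ℝ) else -1) + (if ε 2 then (1 : ℝ) else -1), -(if ε 1 then (1 : ℝ) else -1) - (if ε 2 then (1 : ℝ) else -1)] 0))) : Circle) : ℂ))⁻¹))) * (Φ j ((fun k => x k * Circle.exp (s * (![(if ε 0 then (1 : ℝ) else -1) + (if ε 1 then (1 : ℝ) else -1), -(if ε 0 then (1 : ℝ) else -1) + (if ε 2 then (1 : ℝ) else -1), -(if ε 1 then (1 : ℝ) else -1) - (if ε 2 then (1 : ℝ) else -1)] k))) ∘ ⇑τ))) 0)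
      (𝓝[{x : Fin 3 → Circle | Function.Injective x}] (fun _ => ζ))
      (𝓝 (-((c : ℂ) * Complex.I) * Θt j ((circleDiagonal 3 (fun _ => ζ) : GL (Fin 3) ℂ) : Matrix (Fin 3) (Fin 3) ℂ))) := by
    intro τ j
    have h := hL (Θt j) (hΘt j) (hΘtc j) ζ
    have h' := tendsto_lambda8_rhoWeylDelta_mul_comp_perm (Φ j) τ (ζ := ζ)
      (ℓ := -((c : ℂ) * Complex.I) * Θt j ((circleDiagonal 3 (fun _ => ζ) : GL (Fin 3) ℂ) : Matrix (Fin 3) (Fin 3) ℂ)) (by simpa only [hΦ] using h)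
    simpa only [hΦ] using h'
  have hsum : Tendsto (fun x : Fin 3 → Circle => ∑ τ : Equiv.Perm (Fin 3), ∑ j : J,
      ((1 / 48 : ℂ) * ∑ ε : Fin 3 → Bool, ((((if ε 0 then (1 : ℝ) else -1) * (if ε 1 then (1 : ℝ) else -1) * (if ε 2 then (1 : ℝ) else -1) : ℝ)) : ℂ) *
          iteratedDeriv 3 (fun s : ℝ => ((((((x 0 * Circle.exp (s * (![(if ε 0 then (1 : ℝ) else -1) + (if ε 1 then (1 : ℝ) else -1), -(if ε 0 then (1 : ℝ) else -1) + (if ε 2 then (1 : ℝ) else -1), -(if ε 1 then (1 : ℝ) else -1) - (if ε 2 then (1 : ℝ) else -1)] 0))) : Circle) : ℂ)) * ((((x 2 * Circle.exp (s * (![(if ε 0 then (1 : ℝ) else -1) + (if ε 1 then (1 : ℝ) else -1), -(if ε 0 then (1 : ℝ) else -1) + (if ε 2 then (1 : ℝ) else -1), -(if ε 1 then (1 : ℝ) else -1) - (if ε 2 then (1 : ℝ) else -1)] 2))) : Circle) : ℂ))⁻¹) * ((1 - ((((x 1 * Circle.exp (s * (![(if ε 0 then (1 : ℝ) else -1) +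 (if ε 1 then (1 : ℝ) else -1), -(if ε 0 then (1 : ℝ) else -1) + (if ε 2 then (1 : ℝ) else -1), -(if ε 1 then (1 : ℝ) else -1) - (if ε 2 then (1 : ℝ) else -1)] 1))) : Circle) : ℂ)) * ((((x 0 * Circle.exp (s * (![(if ε 0 then (1 : ℝ) else -1) + (if ε 1 then (1 : ℝ) else -1), -(if ε 0 then (1 : ℝ) else -1) + (if ε 2 then (1 : ℝ) else -1), -(if ε 1 then (1 : ℝ) else -1) - (if ε 2 then (1 : ℝ) else -1)] 0))) : Circle) : ℂ))⁻¹) * (1 - ((((x 2 * Circle.exp (s * (![(if ε 0 then (1 : ℝ) else -1) + (if ε 1 then (1 : ℝ) else -1), -(if ε 0 then (1 : ℝ) else -1) + (if ε 2 then (1 : ℝ) else -1), -(if ε 1 then (1 : ℝ) else -1) - (if ε 2 then (1 : ℝ) else -1)] 2))) : Circle) : ℂ)) * ((((x 1 * Circle.exp (s * (![(if ε 0 then (1 : ℝ) else -1) + (if ε 1 then (1 : ℝ) else -1), -(if ε 0 then (1 : ℝ) else -1) + (if ε 2 then (1 : ℝ) else -1), -(if ε 1 then (1 : ℝ) else -1)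 - (if ε 2 then (1 : ℝ) else -1)] 1))) : Circle) : ℂ))⁻¹) * (1 - ((((x 2 * Circle.exp (s * (![(if ε 0 then (1 : ℝ) else -1) + (if ε 1 then (1 : ℝ) else -1), -(if ε 0 then (1 : ℝ) else -1) + (if ε 2 then (1 : ℝ) else -1), -(if ε 1 then (1 : ℝ) else -1) - (if ε 2 then (1 : ℝ) else -1)] 2))) : Circle) : ℂ)) * ((((x 0 * Circle.exp (s * (![(if ε 0 then (1 : ℝ) else -1) + (if ε 1 then (1 : ℝ) else -1), -(if ε 0 then (1 : ℝ) else -1) + (if ε 2 then (1 : ℝ) else -1), -(if ε 1 then (1 : ℝ) else -1) - (if ε 2 then (1 : ℝ) else -1)] 0))) : Circle) : ℂ))⁻¹))) * (Φ j ((fun k => x k * Circle.exp (s * (![(if ε 0 then (1 : ℝ) else -1) + (if ε 1 then (1 : ℝ) else -1), -(if ε 0 then (1 : ℝ) else -1) + (if ε 2 then (1 : ℝ) else -1), -(if ε 1 then (1 : ℝ) else -1) - (if ε 2 then (1 : ℝ) else -1)] k))) ∘ ⇑τ))) 0))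
      (𝓝[{x : Fin 3 → Circle | Function.Injective x}] (fun _ => ζ))
      (𝓝 (∑ τ : Equiv.Perm (Fin 3), ∑ j : J, -((c : ℂ) * Complex.I) * Θt j ((circleDiagonal 3 (fun _ => ζ) : GL (Fin 3) ℂ) : Matrix (Fin 3) (Fin 3) ℂ))) :=
    tendsto_finsetSum _ fun τ _ => tendsto_finsetSum _ fun j _ => hlim τ j
  -- §c the frozen value
  have hcentre : ∀ j : J, Θt j ((circleDiagonal 3 (fun _ => ζ) : GL (Fin 3) ℂ) : Matrix (Fin 3) (Fin 3) ℂ) = ∫ o : (∀ w' : {w : {w : InfinitePlace L // IsComplex w} // ¬ w = w₁}, archLocal L 3 (Matrix.diagonal α) w'.1),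
            Θ ((((archPiEquivCM 3 L (Matrix.diagonal α)).symm
            ((MeasurableEquiv.piEquivPiSubtypeProd (fun w : {w : InfinitePlace L // IsComplex w} => ↥(archLocal L 3 (Matrix.diagonal α) w)) (· = w₁)).symm
              ((MeasurableEquiv.piUnique fun i : {w : {w : InfinitePlace L // IsComplex w} // w = w₁} => ↥(archLocal L 3 (Matrix.diagonal α) i.1)).symm ((⟨circleDiagonal 3 (fun _ : Fin 3 => ζ), circleDiagonal_mem_archLocal_diagonal L 3 α w₁ _⟩ : archLocal L 3 (Matrix.diagonal α) w₁)), o)) :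
              arch (↥(maximalRealSubfield L)) L (IsCMField.complexConj L) 3 (Matrix.diagonal α)) : GL (Fin 3) (mixedSpace L)) : Matrix (Fin 3) (Fin 3) (mixedSpace L)) ∂(Measure.pi (μ j)) :=
    fun j => hΘteq j (⟨circleDiagonal 3 (fun _ : Fin 3 => ζ), circleDiagonal_mem_archLocal_diagonal L 3 α w₁ _⟩ : archLocal L 3 (Matrix.diagonal α) w₁)
  have hval : (∑ τ : Equiv.Perm (Fin 3), ∑ j : J, -((c : ℂ) * Complex.I) * Θt j ((circleDiagonal 3 (fun _ => ζ) : GL (Fin 3) ℂ) : Matrix (Fin 3) (Fin 3) ℂ)) =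
      -((c : ℂ) * Complex.I) * ∑ _τ : Equiv.Perm (Fin 3), ∑ j : J, ∫ o : (∀ w' : {w : {w : InfinitePlace L // IsComplex w} // ¬ w = w₁}, archLocal L 3 (Matrix.diagonal α) w'.1),
            Θ ((((archPiEquivCM 3 L (Matrix.diagonal α)).symm
            ((MeasurableEquiv.piEquivPiSubtypeProd (fun w : {w : InfinitePlace L // IsComplex w} => ↥(archLocal L 3 (Matrix.diagonal α) w)) (· = w₁)).symm
              ((MeasurableEquiv.piUnique fun i : {w : {w : InfinitePlace L // IsComplex w} // w = w₁} => ↥(archLocal L 3 (Matrix.diagonal α) i.1)).symm ((⟨circleDiagonal 3 (fun _ : Fin 3 => ζ), circleDiagonal_mem_archLocal_diagonal L 3 α w₁ _⟩ : archLocal L 3 (Matrix.diagonal α) w₁)), o)) :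
              arch (↥(maximalRealSubfield L)) L (IsCMField.complexConj L) 3 (Matrix.diagonal α)) : GL (Fin 3) (mixedSpace L)) : Matrix (Fin 3) (Fin 3) (mixedSpace L)) ∂(Measure.pi (μ j)) := by
    simp only [hcentre, ← Finset.mul_sum]
  rw [hval] at hsum
  -- §d at a REGULAR `x` the functional is additive over the labels (★ (A1))
  have h3le : (3 : WithTop ℕ∞) ≤ ∞ := WithTop.coe_le_coe.2 le_top
  have hray : ∀ (x : Fin 3 → Circle), Function.Injective x → ∀ (τ : Equiv.Perm (Fin 3)) (j : J) (u : Fin 3 → ℝ),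
      ContDiffAt ℝ 3 (fun s : ℝ => ((((((x 0 * Circle.exp (s * (u 0))) : Circle) : ℂ)) * ((((x 2 * Circle.exp (s * (u 2))) : Circle) : ℂ))⁻¹) * ((1 - ((((x 1 * Circle.exp (s * (u 1))) : Circle) : ℂ)) * ((((x 0 * Circle.exp (s * (u 0))) : Circle) : ℂ))⁻¹) * (1 - ((((x 2 * Circle.exp (s * (u 2))) : Circle) : ℂ)) * ((((x 1 * Circle.exp (s * (u 1))) : Circle) : ℂ))⁻¹) * (1 - ((((x 2 * Circle.exp (s * (u 2))) : Circle) : ℂ)) * ((((x 0 * Circle.exp (s * (u 0))) : Circle) : ℂ))⁻¹))) * (fun r : Fin 3 → Circle => Φ j (r ∘ ⇑τ)) (fun k => x k * Circle.exp (s * (u k)))) 0 := by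
    intro x hx τ j u
    refine ((contDiff_rhoWeylDelta_ray x u).of_le h3le).contDiffAt.mul ?_
    -- the orbital factor through the angle chart at `x ∘ τ`
    have hfun : (fun s : ℝ => (fun r : Fin 3 → Circle => Φ j (r ∘ ⇑τ)) (fun k => x k * Circle.exp (s * (u k)))) =
        (fun θ : Fin 3 → ℝ => ∫ k : archLocal L 3 (Matrix.diagonal α) w₁, Θt j ((((k * ⟨circleDiagonal 3 fun i => (x ∘ ⇑τ) i * Circle.exp (θ i), circleDiagonal_mem_archLocal_diagonal L 3 α w₁ _⟩ * k⁻¹ :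
          archLocal L 3 (Matrix.diagonal α) w₁) : GL (Fin 3) ℂ) : Matrix (Fin 3) (Fin 3) ℂ)) ∂ν) ∘ fun s : ℝ => s • (u ∘ ⇑τ) := by
      funext s
      simp only [hΦ, Function.comp_apply, Function.comp_def, Pi.smul_apply, smul_eq_mul]
    rw [hfun]
    have hU : {θ : Fin 3 → ℝ | ∀ i j : Fin 3, id i ≠ id j → (x ∘ ⇑τ) i * Circle.exp (θ i) ≠ (x ∘ ⇑τ) j * Circle.exp (θ j)} ∈ 𝓝 ((fun s : ℝ => s • (u ∘ ⇑τ)) 0) := by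
      have hopen : IsOpen {θ : Fin 3 → ℝ | ∀ i j : Fin 3, id i ≠ id j → (x ∘ ⇑τ) i * Circle.exp (θ i) ≠ (x ∘ ⇑τ) j * Circle.exp (θ j)} :=
        (isOpen_setOf_blockSeparated (X := Circle) (id : Fin 3 → Fin 3)).preimage
          (continuous_pi fun i => continuous_const.mul (Circle.exp.continuous.comp (continuous_apply i)))
      refine hopen.mem_nhds ?_
      intro i j hij
      simp only [zero_smul, Pi.zero_apply, Circle.exp_zero, mul_one, Function.comp_apply]
      exact fun h => hij (τ.injective (hx h))
    have hA := (contDiffOn_integral_comp_conj_circleDiagonal_angles_of_blocks L 3 α w₁ hα hreal (id : Fin 3 → Fin 3) (fun i j hij hb => absurd hb hij) ν (Θt j) (hΘt j) (hΘtc j)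
      (x ∘ ⇑τ)).contDiffAt hU
    exact ((hA.of_le h3le).comp 0 ((contDiff_id.smul contDiff_const).contDiffAt.of_le h3le))
  have hray2 : ∀ (x : Fin 3 → Circle), Function.Injective x → ∀ (τ : Equiv.Perm (Fin 3)) (u : Fin 3 → ℝ),
      ContDiffAt ℝ 3 (fun s : ℝ => ((((((x 0 * Circle.exp (s * (u 0))) : Circle) : ℂ)) * ((((x 2 * Circle.exp (s * (u 2))) : Circle) : ℂ))⁻¹) * ((1 - ((((x 1 * Circle.exp (s * (u 1))) : Circle) : ℂ)) * ((((x 0 * Circle.exp (s * (u 0))) : Circle) : ℂ))⁻¹) * (1 - ((((x 2 * Circle.exp (s * (u 2))) : Circle) : ℂ)) * ((((x 1 * Circle.exp (s * (u 1))) : Circle) : ℂ))⁻¹) * (1 - ((((x 2 * Circle.exp (s * (u 2))) : Circle) : ℂ)) * ((((x 0 * Circle.exp (s * (u 0))) : Circle) : ℂ))⁻¹))) * (fun r : Fin 3 → Circle => ∑ j : J, Φ j (r ∘ ⇑τ)) (fun k => x k * Circle.exp (s * (u k)))) 0 := by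
    intro x hx τ u
    have hfun : (fun s : ℝ => ((((((x 0 * Circle.exp (s * (u 0))) : Circle) : ℂ)) * ((((x 2 * Circle.exp (s * (u 2))) : Circle) : ℂ))⁻¹) * ((1 - ((((x 1 * Circle.exp (s * (u 1))) : Circle) : ℂ)) * ((((x 0 * Circle.exp (s * (u 0))) : Circle) : ℂ))⁻¹) * (1 - ((((x 2 * Circle.exp (s * (u 2))) : Circle) : ℂ)) * ((((x 1 * Circle.exp (s * (u 1))) : Circle) : ℂ))⁻¹) * (1 - ((((x 2 * Circle.exp (s * (u 2))) : Circle) : ℂ)) * ((((x 0 * Circle.exp (s * (u 0))) : Circle) : ℂ))⁻¹))) * (fun r : Fin 3 → Circle => ∑ j : J, Φ j (r ∘ ⇑τ)) (fun k => x k * Circle.exp (s * (u k)))) =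
        fun s : ℝ => ∑ j : J, ((((((x 0 * Circle.exp (s * (u 0))) : Circle) : ℂ)) * ((((x 2 * Circle.exp (s * (u 2))) : Circle) : ℂ))⁻¹) * ((1 - ((((x 1 * Circle.exp (s * (u 1))) : Circle) : ℂ)) * ((((x 0 * Circle.exp (s * (u 0))) : Circle) : ℂ))⁻¹) * (1 - ((((x 2 * Circle.exp (s * (u 2))) : Circle) : ℂ)) * ((((x 1 * Circle.exp (s * (u 1))) : Circle) : ℂ))⁻¹) * (1 - ((((x 2 * Circle.exp (s * (u 2))) : Circle) : ℂ)) * ((((x 0 * Circle.exp (s * (u 0))) : Circle) : ℂ))⁻¹))) * (fun r : Fin 3 → Circle => Φ j (r ∘ ⇑τ)) (fun k => x k * Circle.exp (s * (u k))) := by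
      funext s; simp only [Finset.mul_sum]
    rw [hfun]
    exact ContDiffAt.sum fun j _ => hray x hx τ j u
  -- §e assemble: on the regular set the functional IS the label sum of §b
  refine hsum.congr' ?_
  filter_upwards [self_mem_nhdsWithin] with x hx
  have e2 := fun τ : Equiv.Perm (Fin 3) =>
    lambda8_rhoWeylDelta_mul_finset_sum Finset.univ (fun j : J => fun r : Fin 3 → Circle => Φ j (r ∘ ⇑τ)) x (fun j _ u => hray x hx τ j u)
  have e1 := lambda8_rhoWeylDelta_mul_finset_sum Finset.univ (fun τ : Equiv.Perm (Fin 3) => fun r : Fin 3 → Circle => ∑ j : J, Φ j (r ∘ ⇑τ)) x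
    (fun τ _ u => hray2 x hx τ u)
  beta_reduce at e1 e2
  simp only [← e2]
  rw [← e1]
  simp only [hΦ, ← hΘteq]

end Engine


end Literature.NumberTheory.Automorphic.UnitaryGroup

end
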